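import Summits.QuantumFields.YangMills.Theorems.FluctuationComparisonRegPrIntLS2BetaCanonicalCurrency
import Summits.QuantumFields.YangMills.Theorems.FluctuationComparisonRegPrIntLS2BetaKPLogRep
import HarnessLib

/-!
# THE LAST MILE OF R590 (18) item (1): the INTERIOR gas identity LFG^{can}∘ on the canonical pair ⟹ the REGISTERED stub LFR♯ᶜ∘ `LargeFieldFourPtIntCan`
# (registry `Lines/semiclassical_s2beta.lean` v11.4 3732b7df :588, `stub_largeFieldFourPtIntCan` :1584) VERBATIM — ★★OWNER g39 RULING №57 (B)'s «interior re-docking»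

Cell `ym3-torus` (HUMAN RULING D-0037: rung R3 = continuum `SU(2)` Yang–Mills on `T³` — NOT `d = 4`, NOT infinite volume, NOT a mass gap, NOT the Clay problem); width seat
`ym3-torus-px10` (gen 16); helper of the crux `stmt-QuantumFields-20520` `UnitScaleTilt.FluctuationComparisonRegPrIntL` (`--supports … --as helper`, NOT a proof of it); LOCATE
`LOCATE-LFG-px10g16.md` (20520 evidence #41); FILE 2 (FILE 1 = `…LargeFieldGasCanonicalCurrency`: LFG ⟺ LFG^{can} on the FULL window + the depth-zero body).
THEOREMS ONLY: 0 `def`, 0 `instance`, 0 `notation`, 0 `sorry`, default heartbeats.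

CONTEXT (RULING №57).  LINE g19-1 `Lines/largefield_gas.lean` v3 types the 𝐑-operation's output LFG and its target LFRᶜ on the FULL window `{PlaqSmall (θBal F.L γ b₀ p₀ J)}`,
and the registry proves only the FULL-window shadow `largeFieldFourPtCan_of_polymerRep` (:816); but since v11.4 the registry's large-field row is the INTERIOR-window one,
LFR♯ᶜ∘ `LargeFieldFourPtIntCan` (:588): prefix `∀ L, ∃ c₀ ∈ (0,1], ∀ c ∈ (0,c₀], ∃ pS …`, the version `ρ` positive and continuous on the INTERIOR window
`W_J^{c} = {PlaqSmall (θBal F.L γ (c·b₀) p₀ J)}`, the canonical `hist(b₀)` density positive there, and the connected 4-points of `log ρ − log heightDensityCan^{histGood(b₀)}` at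
interior quadrilaterals `≤ ψ J·e^{−κ d}` — «the interior re-docking `… → LargeFieldFourPtIntCan` is part of prover-1's deliverable».  THIS FILE discharges that re-docking ONCE, for
the natural output of a hand on the 𝐑-operation in canonical currency:

  LFG^{can}∘ := LFG^{can} (FILE 1) with the registry's interior prefix `∀ L, ∃ c₀, 0 < c₀ ∧ c₀ ≤ 1 ∧ ∀ c, 0 < c → c ≤ c₀ →` spliced after `∀ L,` and EVERY window clause read
  at `c·b₀` — rows (r1∘) `W_J^{c} ⊆ Node00.regSet dU (heightDensity F γ hJK univ)`, (r2∘) `0 < heightDensityCan … univ` on `W_J^{c}`, (hgpos∘) `0 < heightDensityCan … (histGood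
  (θBal b₀) K J)` on `W_J^{c}`, the Kotecký–Preiss block `KPGasOn W_J^{c} κ (Ψ J) w` (δ-unfolded as KPL-D), and the identity
  `heightDensityCan … univ U = e^{cst}·heightDensityCan … (histGood (θBal b₀) K J) U·Ξ(w_U)` for `U ∈ W_J^{c}` (the history profile stays `b₀`, exactly as in :588).

* §1 `fourPoint_le_of_repNorm` — the 4-point shadow of a V-local polymer representation (`Fin n` families, `IsLocal` unfolded): `|Δ_bΔ_{b′}(c + Σ act)| ≤ 4N·e^{−κ·tdist(b,b′)}`
  — PROOF LIFTED BY TEXT from LINE g18-3 `Lines/polymer_norm_s2beta.lean` §1 `fourPoint_le_of_polymerNorm` (ideator `ym-r3-idea-1` g18; Lines modules are not importable; credit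
  theirs).
* §2 ★★`largeFieldFourPtIntCan_of_canInt : ⟨LFG^{can}∘⟩ → ⟨LargeFieldFourPtIntCan :588 VERBATIM, δ-unfolded (`fourPt`, `heightDensityCan` = ✓WregGlue's)⟩` — same `c₀ pS γ₁ κ`,
  `ψ := 4·Ψ`: given the registry's admissible `(ν, ρ)` on `W_J^{c}`, ✓`version_rows` (read at thresholds `c·b₀`) supplies (r1∘)(r2∘) and `log ρ = log heightDensityCan … univ − log Z_K`
  on `W_J^{c}`; LFG^{can}∘ gives the gas; KPL-D ✓`kpLogRep` represents `log Ξ(w_·)` on `W_J^{c}`; so `log ρ − log heightDensityCan^{hist} = (cst − log Z_K + c′) + Σ_X act X` there and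
  §1 bounds its connected 4-points.

WHAT IT BUYS (honest; CREDITS NOTHING): the registered stub is now ONE `exact largeFieldFourPtIntCan_of_canInt h` away from any proof `h` of the interior gas identity on the
canonical pair — the 𝐑-operation hand (RULING №57's prover-1) types against `(heightDensityCan … univ, heightDensityCan … histGood)` on the interior window and nothing else.
NOTHING of the 𝐑-operation (depth ≥ 1) is touched; LFG∕LFG^{can}∘∕LFRᶜ∕LFR♯ᶜ∘∕S2β, the crux 20520, EX∕19200, 19936 are NOT proved; `YM3TorusSU2` NOT proved; the Yang–Mills mass
gap (Clay) NOT proved; rung R3 = YM₃ on `T³` — NOT `d = 4`, NOT infinite volume, NOT a mass gap.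
References: [Balaban1985UV3] T. Bałaban, CMP 102 (1985) 255–275: (2) p.256, (41) p.266; [Balaban1989LargeFieldII] CMP 122 (1989): (1.90) p.388, (1.97)–(1.101) pp.389–390;
[Balaban1987RG1] CMP 109 (1987): (0.23)–(0.26) pp.256–257; [Balaban1988Convergent] CMP 119 (1988) §2 (2.18)–(2.27); [KoteckyPreiss1986] CMP 103 (1986), Theorem p.492.
-/

set_option autoImplicit false

noncomputable section

open MeasureTheory Filter Topology Set
open scoped ENNReal
open Literature.Probability.LatticeModels (polyInc polymerPartitionFunction)
open Literature.MathematicalPhysics.QuantumFieldTheory.Balaban1983to89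
open Literature.MathematicalPhysics.QuantumFieldTheory.Balaban1983to89.T3ContinuumYM3Torus
open Literature.MathematicalPhysics.QuantumFieldTheory.Balaban1983to89.T3NestedUnitLaws
open Literature.MathematicalPhysics.QuantumFieldTheory.Balaban1983to89.T3UnitLawDensityEML
open Literature.MathematicalPhysics.QuantumFieldTheory.Balaban1983to89.T3UnitScaleTilt
open Literature.MathematicalPhysics.QuantumFieldTheory.Balaban1983to89.T3TiltDescent
open Literature.MathematicalPhysics.QuantumFieldTheory.Balaban1983to89.T3PrintedRegularMinimiser
open Literature.MathematicalPhysics.QuantumFieldTheory.Balaban1983to89.T3LevelShift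
open Literature.MathematicalPhysics.QuantumFieldTheory.Balaban1983to89.Missing
open Literature.MathematicalPhysics.QuantumFieldTheory.Balaban1983to89.T4Continuum
open scoped Literature.MathematicalPhysics.QuantumFieldTheory.Balaban1983to89.T3OrbitAverage
open Summit.QuantumFields.YangMills.Theorems.FluctuationComparisonRegPrIntLWregGlue (heightDensityCan)
open Summit.QuantumFields.YangMills.Theorems.FluctuationComparisonRegPrIntLS2BetaCanonicalCurrency (version_rows)
open Summit.QuantumFields.YangMills.Theorems.FluctuationComparisonRegPrIntLS2BetaKPLogRep (kpLogRep')

namespace Summit.QuantumFields.YangMills.Theorems.FluctuationComparisonRegPrIntLLargeFieldGasInteriorDoor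

/-! ## §1 The 4-point shadow of a V-local polymer representation (lifted from LINE g18-3 §1) -/

section FourPoint

variable {P : Params} {G : Type*} {n : ℕ}

open Classical in
/-- **POLYMER NORM ⇒ κ-CLUSTERED CONNECTED 4-POINTS**: under the four one-bond window moves at bonds `b, b′`, the polymers whose support misses `b` or misses `b′` cancel
EXACTLY by V-locality; each survivor contributes `≤ 4·wt X ≤ 4·wt X·e^{κ len X}·e^{−κ·tdist(b,b′)}` (`len X ≥ tdist`), and the weighted norm sums them.  Proof lifted by text from
`Lines/polymer_norm_s2beta.lean` §1 `fourPoint_le_of_polymerNorm` (ideator ym-r3-idea-1 g18), `IsLocal` unfolded. [cite: Balaban1987RG1, (0.23)-(0.26) pp.256-257] -/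
theorem fourPoint_le_of_repNorm (W : Set (GaugeField P 0 G)) (supp : Fin n → Finset (PBond P 0)) (len wt : Fin n → ℝ)
    (act : Fin n → GaugeField P 0 G → ℝ) (κ N c : ℝ) (hκ : 0 ≤ κ)
    (hloc : ∀ X (U U' : GaugeField P 0 G), (∀ e ∈ supp X, U e = U' e) → act X U = act X U') (hwt : ∀ X, 0 ≤ wt X)
    (hdiam : ∀ X, ∀ e ∈ supp X, ∀ e' ∈ supp X, (e.src.tdist e'.src : ℝ) ≤ len X)
    (hbd : ∀ X U, U ∈ W → |act X U| ≤ wt X)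
    (hcov : ∀ e : PBond P 0, ∑ X ∈ Finset.univ.filter (fun X => e ∈ supp X), wt X * Real.exp (κ * len X) ≤ N)
    (b b' : PBond P 0) (U V Y Z : GaugeField P 0 G) (hU : U ∈ W) (hV : V ∈ W) (hY : Y ∈ W) (hZ : Z ∈ W)
    (hUV : ∀ e, e ≠ b → U e = V e) (hUY : ∀ e, e ≠ b' → U e = Y e) (hVZ : ∀ e, e ≠ b' → V e = Z e)
    (hYZ : ∀ e, e ≠ b → Y e = Z e) :
    |((c + ∑ X, act X U) - (c + ∑ X, act X V)) - ((c + ∑ X, act X Y) - (c + ∑ X, act X Z))|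
      ≤ 4 * N * Real.exp (-(κ * (b.src.tdist b'.src : ℝ))) := by
  set d : ℝ := (b.src.tdist b'.src : ℝ) with hd
  have hT : ((c + ∑ X, act X U) - (c + ∑ X, act X V)) - ((c + ∑ X, act X Y) - (c + ∑ X, act X Z))
      = ∑ X, ((act X U - act X V) - (act X Y - act X Z)) := by
    simp only [Finset.sum_sub_distrib]; ring
  rw [hT]
  have hpt : ∀ X, |(act X U - act X V) - (act X Y - act X Z)|
      ≤ if b ∈ supp X then 4 * (wt X * Real.exp (κ * len X)) * Real.exp (-(κ * d)) else 0 := by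
    intro X
    by_cases hb : b ∈ supp X
    · rw [if_pos hb]
      by_cases hb' : b' ∈ supp X
      · have hdle : d ≤ len X := hdiam X b hb b' hb'
        have hkey : wt X ≤ wt X * Real.exp (κ * len X) * Real.exp (-(κ * d)) := by
          rw [mul_assoc, ← Real.exp_add]
          have h0 : 0 ≤ κ * len X + -(κ * d) := by nlinarith
          calc wt X = wt X * 1 := (mul_one _).symm
            _ ≤ wt X * Real.exp (κ * len X + -(κ * d)) := mul_le_mul_of_nonneg_left (Real.one_le_exp h0) (hwt X)
        have h1 := abs_le.mp (hbd X U hU)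
        have h2 := abs_le.mp (hbd X V hV)
        have h3 := abs_le.mp (hbd X Y hY)
        have h4 := abs_le.mp (hbd X Z hZ)
        have h5 : |(act X U - act X V) - (act X Y - act X Z)| ≤ 4 * wt X :=
          abs_le.mpr ⟨by linarith [h1.1, h2.2, h3.2, h4.1], by linarith [h1.2, h2.1, h3.1, h4.2]⟩
        calc |(act X U - act X V) - (act X Y - act X Z)| ≤ 4 * wt X := h5
          _ ≤ 4 * (wt X * Real.exp (κ * len X) * Real.exp (-(κ * d))) := by linarith
          _ = 4 * (wt X * Real.exp (κ * len X)) * Real.exp (-(κ * d)) := by ring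
      · have e1 : act X U = act X Y := hloc X U Y (fun e he => hUY e (fun h => hb' (h ▸ he)))
        have e2 : act X V = act X Z := hloc X V Z (fun e he => hVZ e (fun h => hb' (h ▸ he)))
        have hw := hwt X
        rw [e1, e2]
        simp only [sub_self, abs_zero]
        positivity
    · rw [if_neg hb]
      have e1 : act X U = act X V := hloc X U V (fun e he => hUV e (fun h => hb (h ▸ he)))
      have e2 : act X Y = act X Z := hloc X Y Z (fun e he => hYZ e (fun h => hb (h ▸ he)))
      rw [e1, e2]
      simp only [sub_self, abs_zero, le_refl]
  calc |∑ X, ((act X U - act X V) - (act X Y - act X Z))|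
      ≤ ∑ X, |(act X U - act X V) - (act X Y - act X Z)| := Finset.abs_sum_le_sum_abs _ _
    _ ≤ ∑ X, (if b ∈ supp X then 4 * (wt X * Real.exp (κ * len X)) * Real.exp (-(κ * d)) else 0) :=
        Finset.sum_le_sum (fun X _ => hpt X)
    _ = (∑ X ∈ Finset.univ.filter (fun X => b ∈ supp X), wt X * Real.exp (κ * len X)) * (4 * Real.exp (-(κ * d))) := by
        rw [Finset.sum_filter, Finset.sum_mul]
        refine Finset.sum_congr rfl (fun X _ => ?_)
        split_ifs <;> ring
    _ ≤ N * (4 * Real.exp (-(κ * d))) := by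
        have h4 : 0 ≤ 4 * Real.exp (-(κ * d)) := by positivity
        exact mul_le_mul_of_nonneg_right (hcov b) h4
    _ = 4 * N * Real.exp (-(κ * d)) := by ring

end FourPoint

/-! ## §2 The door: LFG^{can}∘ (interior gas identity on the canonical pair) ⟹ the registered LFR♯ᶜ∘ `LargeFieldFourPtIntCan` VERBATIM -/

section Door

open Classical in
/-- ★★ **THE REGISTERED STUB `LargeFieldFourPtIntCan` (registry v11.4 :588, VERBATIM, δ-unfolded) FROM THE INTERIOR CANONICAL GAS IDENTITY LFG^{can}∘** (same `c₀ pS γ₁ κ`;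
`ψ := 4·Ψ`): the version is read back by ✓`version_rows` at thresholds `c·b₀` (`log ρ = log heightDensityCan … univ − log Z_K` on `W_J^{c}`), the gas is logged by KPL-D ✓`kpLogRep'`,
and the connected 4-point of `(cst − log Z_K + c′) + Σ_X act X` is bounded by §1.  RULING №57 (B)'s interior re-docking, discharged.
[cite: Balaban1989LargeFieldII, (1.90) p.388 and (1.98)-(1.101) p.390; Balaban1987RG1, (0.23)-(0.26) pp.256-257; Balaban1988Convergent, §2 (2.18)-(2.27)] -/
theorem largeFieldFourPtIntCan_of_canInt
    (h : ∀ (L : ℕ), ∃ c₀ : ℝ, 0 < c₀ ∧ c₀ ≤ 1 ∧ ∀ (c : ℝ), 0 < c → c ≤ c₀ → ∃ pS : ℝ, ∀ (b₀ p₀ : ℝ), 0 < b₀ → pS ≤ p₀ → 0 < p₀ →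
      ∃ γ₁ : ℝ, 0 < γ₁ ∧ ∃ κ : ℝ, 0 < κ ∧ ∀ (F : T3Family) (γ : ℝ), F.L = L → 0 < γ → γ ≤ γ₁ →
        ∃ Ψ : ℕ → ℝ, (∀ J, 0 ≤ Ψ J) ∧ Tendsto (fun J : ℕ => (J : ℝ) * Ψ J) atTop (𝓝 0) ∧
          ∀ (J K : ℕ) (hJK : J ≤ K),
            {U : GaugeField (F.P J) 0 (Matrix.specialUnitaryGroup (Fin 2) ℂ) | PlaqSmall (θBal F.L γ (c * b₀) p₀ J) U} ⊆
              Node00.regSet (fieldMeasure (F.P J) 0 (Matrix.specialUnitaryGroup (Fin 2) ℂ)) (heightDensity F γ hJK Set.univ) →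
            (∀ U : GaugeField (F.P J) 0 (Matrix.specialUnitaryGroup (Fin 2) ℂ), PlaqSmall (θBal F.L γ (c * b₀) p₀ J) U →
                0 < heightDensityCan F γ hJK Set.univ U) →
            (∀ U : GaugeField (F.P J) 0 (Matrix.specialUnitaryGroup (Fin 2) ℂ), PlaqSmall (θBal F.L γ (c * b₀) p₀ J) U →
                0 < heightDensityCan F γ hJK (histGood F ℰp (θBal F.L γ b₀ p₀) K J) U) →
            ∃ (cst : ℝ) (w : GaugeField (F.P J) 0 (Matrix.specialUnitaryGroup (Fin 2) ℂ) → Finset (PBond (F.P J) 0) → ℝ),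
              (∃ (wbar a ℓ : Finset (PBond (F.P J) 0) → ℝ),
                (∀ U, w U ∅ = 0) ∧
                (∀ (X : Finset (PBond (F.P J) 0)) (U U' : GaugeField (F.P J) 0 (Matrix.specialUnitaryGroup (Fin 2) ℂ)),
                  (∀ e ∈ X, U e = U' e) → w U X = w U' X) ∧
                (∀ X, 0 ≤ a X) ∧ (∀ X, 0 ≤ ℓ X) ∧
                (∀ U, U ∈ {U : GaugeField (F.P J) 0 (Matrix.specialUnitaryGroup (Fin 2) ℂ) | PlaqSmall (θBal F.L γ (c * b₀) p₀ J) U} →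
                  ∀ X, |w U X| ≤ wbar X) ∧
                (∀ X : Finset (PBond (F.P J) 0), ∀ e ∈ X, ∀ e' ∈ X, (e.src.tdist e'.src : ℝ) ≤ ℓ X) ∧
                (∀ X : Finset (PBond (F.P J) 0), ∑ X' ∈ Finset.univ.filter (fun X' => polyInc X' X),
                    wbar X' * Real.exp (a X' + κ * ℓ X') ≤ a X) ∧
                (∀ e : PBond (F.P J) 0, a {e} ≤ Ψ J)) ∧
              ∀ U : GaugeField (F.P J) 0 (Matrix.specialUnitaryGroup (Fin 2) ℂ), PlaqSmall (θBal F.L γ (c * b₀) p₀ J) U →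
                heightDensityCan F γ hJK Set.univ U =
                  Real.exp cst * heightDensityCan F γ hJK (histGood F ℰp (θBal F.L γ b₀ p₀) K J) U *
                    (polymerPartitionFunction polyInc (fun X : Finset (PBond (F.P J) 0) => ((w U X : ℝ) : ℂ)) Finset.univ).re) :
    ∀ (L : ℕ), ∃ c₀ : ℝ, 0 < c₀ ∧ c₀ ≤ 1 ∧ ∀ (c : ℝ), 0 < c → c ≤ c₀ → ∃ pS : ℝ, ∀ (b₀ p₀ : ℝ), 0 < b₀ → pS ≤ p₀ → 0 < p₀ →
      ∃ γ₁ : ℝ, 0 < γ₁ ∧ ∃ κ : ℝ, 0 < κ ∧ ∀ (F : T3Family) (γ : ℝ), F.L = L → 0 < γ → γ ≤ γ₁ →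
        ∃ ψ : ℕ → ℝ, (∀ J, 0 ≤ ψ J) ∧ Tendsto (fun J : ℕ => (J : ℝ) * ψ J) atTop (𝓝 0) ∧
          ∀ (ν : ℕ → (j : ℕ) → Measure (GaugeField (F.P j) 0 (Matrix.specialUnitaryGroup (Fin 2) ℂ))),
            (∀ K, ν K K = T4GenFunBounds.gibbsMeasure (F.P K) ((F.scheme ℰp γ).β K)) →
            (∀ K j, j < K → ν K j = Measure.map (descend F ℰp j) (ν K (j + 1))) →
            ∀ (J K : ℕ) (hJK : J ≤ K) (ρ : GaugeField (F.P J) 0 (Matrix.specialUnitaryGroup (Fin 2) ℂ) → ℝ),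
              (∀ U, PlaqSmall (θBal F.L γ (c * b₀) p₀ J) U → 0 < ρ U) →
              ν K J = (fieldMeasure _ _ _).withDensity (fun U => ENNReal.ofReal (ρ U)) →
              ContinuousOn ρ {U | PlaqSmall (θBal F.L γ (c * b₀) p₀ J) U} →
              (∀ U : GaugeField (F.P J) 0 (Matrix.specialUnitaryGroup (Fin 2) ℂ), PlaqSmall (θBal F.L γ (c * b₀) p₀ J) U →
                  0 < heightDensityCan F γ hJK (histGood F ℰp (θBal F.L γ b₀ p₀) K J) U) →
              ∀ (b b' : PBond (F.P J) 0) (U V W Z : GaugeField (F.P J) 0 (Matrix.specialUnitaryGroup (Fin 2) ℂ)),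
                PlaqSmall (θBal F.L γ (c * b₀) p₀ J) U → PlaqSmall (θBal F.L γ (c * b₀) p₀ J) V →
                PlaqSmall (θBal F.L γ (c * b₀) p₀ J) W → PlaqSmall (θBal F.L γ (c * b₀) p₀ J) Z →
                (∀ e, e ≠ b → U e = V e) → (∀ e, e ≠ b' → U e = W e) → (∀ e, e ≠ b' → V e = Z e) → (∀ e, e ≠ b → W e = Z e) →
                |((fun U => Real.log (ρ U) - Real.log (heightDensityCan F γ hJK (histGood F ℰp (θBal F.L γ b₀ p₀) K J) U)) U -
                    (fun U => Real.log (ρ U) - Real.log (heightDensityCan F γ hJK (histGood F ℰp (θBal F.L γ b₀ p₀) K J) U)) V) -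
                  ((fun U => Real.log (ρ U) - Real.log (heightDensityCan F γ hJK (histGood F ℰp (θBal F.L γ b₀ p₀) K J) U)) W -
                    (fun U => Real.log (ρ U) - Real.log (heightDensityCan F γ hJK (histGood F ℰp (θBal F.L γ b₀ p₀) K J) U)) Z)|
                  ≤ ψ J * Real.exp (-(κ * (b.src.tdist b'.src : ℝ))) := by
  intro L
  obtain ⟨c₀, hc₀, hc₀1, H⟩ := h L
  refine ⟨c₀, hc₀, hc₀1, fun c hc hcc₀ => ?_⟩
  obtain ⟨pS, H⟩ := H c hc hcc₀
  refine ⟨pS, fun b₀ p₀ hb hpS hp => ?_⟩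
  obtain ⟨γ₁, hγ₁, κ, hκ, H⟩ := H b₀ p₀ hb hpS hp
  refine ⟨γ₁, hγ₁, κ, hκ, fun F γ hFL hγ hγle => ?_⟩
  obtain ⟨Ψ, hΨ0, hΨt, H⟩ := H F γ hFL hγ hγle
  refine ⟨fun J => 4 * Ψ J, fun J => by have := hΨ0 J; positivity, ?_, ?_⟩
  · have ht := hΨt.const_mul 4
    rw [mul_zero] at ht
    refine ht.congr' (Eventually.of_forall fun J => ?_)
    show 4 * ((J : ℝ) * Ψ J) = (J : ℝ) * (4 * Ψ J)
    ring
  intro ν hνK hνd J K hJK ρ hρpos hνρ hρc hgpos b b' U V W Z hU hV hW hZ hUV hUW hVZ hWZ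
  -- the version read back on the canonical full density, at thresholds `c·b₀`
  obtain ⟨hR, hP, hlog⟩ := version_rows F (c * b₀) p₀ hJK hγ ν hνK hνd ρ hρpos hνρ hρc
  obtain ⟨cst, w, hgas, hid⟩ := H J K hJK hR hP hgpos
  set Zp : ℝ := partitionFn (G := Matrix.specialUnitaryGroup (Fin 2) ℂ) (F.P K) ((F.scheme ℰp γ).β K) with hZp
  -- KPL: the gas logged on the interior window
  obtain ⟨n, supp, len, wt, act, c', hloc, hwt, hdiam, hbd, hcov, hrep⟩ :=
    kpLogRep' {U : GaugeField (F.P J) 0 (Matrix.specialUnitaryGroup (Fin 2) ℂ) | PlaqSmall (θBal F.L γ (c * b₀) p₀ J) U} κ (Ψ J) hκ.le w hgas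
  -- the represented function on the window
  have hf : ∀ X : GaugeField (F.P J) 0 (Matrix.specialUnitaryGroup (Fin 2) ℂ), PlaqSmall (θBal F.L γ (c * b₀) p₀ J) X →
      Real.log (ρ X) - Real.log (heightDensityCan F γ hJK (histGood F ℰp (θBal F.L γ b₀ p₀) K J) X) =
        (cst - Real.log Zp + c') + ∑ i, act i X := by
    intro X hX
    have hgX := hgpos X hX
    have huX := hP X hX
    have hidX := hid X hX
    have hΞpos : 0 < (polymerPartitionFunction polyInc (fun Y : Finset (PBond (F.P J) 0) => ((w X Y : ℝ) : ℂ)) Finset.univ).re := by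
      by_contra hle
      have h1 : heightDensityCan F γ hJK Set.univ X ≤ 0 := by
        rw [hidX]
        exact mul_nonpos_of_nonneg_of_nonpos (mul_pos (Real.exp_pos _) hgX).le (not_lt.mp hle)
      exact absurd huX (not_lt.mpr h1)
    have hlogu : Real.log (heightDensityCan F γ hJK Set.univ X) =
        cst + Real.log (heightDensityCan F γ hJK (histGood F ℰp (θBal F.L γ b₀ p₀) K J) X) +
          Real.log ((polymerPartitionFunction polyInc (fun Y : Finset (PBond (F.P J) 0) => ((w X Y : ℝ) : ℂ)) Finset.univ).re) := by
      rw [hidX, Real.log_mul (mul_pos (Real.exp_pos _) hgX).ne' hΞpos.ne', Real.log_mul (Real.exp_pos _).ne' hgX.ne', Real.log_exp]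
    rw [hlog X hX, hlogu, hrep X hX]
    ring
  have key := fourPoint_le_of_repNorm {U : GaugeField (F.P J) 0 (Matrix.specialUnitaryGroup (Fin 2) ℂ) | PlaqSmall (θBal F.L γ (c * b₀) p₀ J) U}
    supp len wt act κ (Ψ J) (cst - Real.log Zp + c') hκ.le hloc hwt hdiam hbd hcov b b' U V W Z hU hV hW hZ hUV hUW hVZ hWZ
  simp only [hf U hU, hf V hV, hf W hW, hf Z hZ]
  calc |((cst - Real.log Zp + c' + ∑ i, act i U) - (cst - Real.log Zp + c' + ∑ i, act i V)) -
          ((cst - Real.log Zp + c' + ∑ i, act i W) - (cst - Real.log Zp + c' + ∑ i, act i Z))|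
        ≤ 4 * Ψ J * Real.exp (-(κ * (b.src.tdist b'.src : ℝ))) := key
    _ = (4 * Ψ J) * Real.exp (-(κ * (b.src.tdist b'.src : ℝ))) := by ring

end Door

end Summit.QuantumFields.YangMills.Theorems.FluctuationComparisonRegPrIntLLargeFieldGasInteriorDoor

end
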